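import Literature.MathematicalPhysics.QuantumFieldTheory.Balaban1983to89.B8SockLettersRD
import Literature.MathematicalPhysics.QuantumFieldTheory.Balaban1983to89.B9B8AveragingKernelZd
import Literature.MathematicalPhysics.QuantumFieldTheory.Balaban1983to89.B8TowerBondsLayerLawSubD

/-!
# `Balaban1983to89.B8SockLettersRDInterpOfLamTop` — POSITIVE TWIN of `B8SockLettersRDIdxB8LawsBVacuity` §2 ON THE REPAIRED INDEX: [Balaban1985BackgroundPropagators]
# Thm 3.1's INTERPOLATION LETTER `H′` with `Q′_j(U₀)(H′Y)(y) = Y(j, y)` ON EVERY CONSTRAINT POINT (conjunct 11 of `B8SockLettersRD.SockLettersRD`; print (1.107) ∕ «Q′H′ = I»)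
# EXISTS AT EVERY (1.3)–(1.5)-ADMISSIBLE LAW MEMBER, EVERY TRUNCATION `n ≤ k`, EVERY BACKGROUND — by the blockwise transported constant

statement-level skeleton of published theorems with citation tags; proofs where landed; nothing here is a claim about the Yang–Mills mass gap

T. Bałaban, *Spaces of regular gauge field configurations on a lattice and gauge fixing conditions*, Commun. Math. Phys. **99** (1985) 75–102
`[Balaban1985RegularSpaces]` ("B8"; journal page = PDF page + 74): (1.3)–(1.6) p. 77 («Λ_j = Ω_j^{(j)} ∖ Ω_{j+1}^{(j)}», «Ω = ⋃_j Bʲ(Λ_j)»), (1.91)–(1.92) p. 91, (1.107) p. 94.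
T. Bałaban, *Propagators for lattice gauge theories in a background field*, Commun. Math. Phys. **99** (1985) 389–434 `[Balaban1985BackgroundPropagators]` ("[4]"): (3.16)–(3.19)
p. 393 (`𝔅_k`, `Q′_j(U) = Q′(Ūʲ⁻¹)⋯Q′(U)`, second form «`Σ_{x∈Bʲ(y)} L^{−jd} R(U(Γ^{(j)}_{y,x})) λ(x)`»), Thm 3.1 p. 397 (the operator `H′` with `Q′H′ = I` on functions on `𝔅_k`).
T. Bałaban, *Averaging operations for lattice gauge theories*, Commun. Math. Phys. **98** (1985) 17–51 `[Balaban1985Averaging]` ("[3]"): (52)–(53) p. 27 (the composite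
contours), (56) p. 27 (`R(X)Y = XYX⁻¹`), Prop. 2 (52)–(53) p. 26 (the averaged backgrounds `Ū₀ʲ` stay in the gauge group).

## WHY THIS FILE (cell `pub-ymgap`, HUMAN RULING D-0062; width seat `pub-ymgap-dag-n05-w1` g3, DAG node N05 = [B8]; proof lane, count-neutral)

This seat's g2 certificate `B8SockLettersRDIdxB8LawsBVacuity` (p613168) killed the N05 knits' [4]-letters binders `SLet ∕ SLetUB` as then keyed: at the all-`univ` datum `i⋆`
(lawful, (1.3)–(1.4)-admissible, but violating print's (1.5)) the INTERPOLATION CLAUSE «`Q′_j(U₀)(H′Y)(y) = Y(j, y)` for every `j ≤ n` and every `y ∈ Λ_j`» is contradictory for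
EVERY map `H′` (`interp_clause_false`).  The repair of record re-keyed the binders on the (1.5)-obeying members (the face `∀ l < k, ∀ z ∈ Λs k l, Lˡ•z ∈ Lam L Ω l`; dag-n05-d's P₂D
wave p619291, dag-n05-c's `B8IdxB8LamTopTowerDisjoint`, this seat's `Node00.IdxB8SubD`), and referee ref-A's census (g29-16) recorded that the face EXCLUDES `i⋆` — which removes the
one known witness but does not by itself show the clause consistent anywhere.  THIS FILE closes that point for the whole repaired class: at EVERY member obeying the located laws,
(1.3)–(1.4) and the (1.5) face, at EVERY truncation `n ≤ k` and for EVERY background `U₀`, a `ℂ`-linear `H′ : XSpace → (ℤᵈ → 𝔸)` satisfying the interpolation clause EXISTS, and it can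
be taken supported on the constraint towers (so conjunct 9 «`H′X = 0` off `Ω₀`» holds), bounded by `‖H′X(x)‖ ≤ ‖X‖` (conjunct 6 with `B₀′_H := 1`) and real (conjunct 10) as soon as
the averaged backgrounds `Ū₀ˡ`, `l < n`, are unitary-valued ([3] Prop. 2; automatic at `U₀ = 1`).

THE WITNESS (declared up front — it is NOT Bałaban's `H′ = G′Q′*(Q′G′²Q′*)⁻¹…`-type minimiser, only a consistency witness): by (1.5) the constraint towers `{Bʲ(y) : j ≤ n, y ∈ Λ_j}`
of a truncation are PAIRWISE DISJOINT (dag-n05-c's `towers_disjoint_of_lamTop_blockMap`), so every fine site `x` lies under AT MOST ONE constraint point `(j, y)`; put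
`(H′Y)(x) := R(T^{(j)}(y, x))⁻¹ Y(j, y)` there (`T^{(j)}` the composite transporter of [3] (52)–(53) ∕ [4] (3.19), `B9B8AveragingKernelZd.compT`) and `0` elsewhere.  By the
kernel form of `Q′_j` (`QprimeIter_zd_eq_sum_blockIter`: `(Q′_jμ)(y) = Σ_{x∈Bʲ(y)} (L⁻ᵈ)ʲ R(T^{(j)}(y,x)) μ(x)`) every summand is `(L⁻ᵈ)ʲ Y(j, y)` and there are `(Lᵈ)ʲ` of them.

## WHAT IS PROVED (kernel, 0 sorry, 0 def; axioms `propext` ∕ `Classical.choice` ∕ `Quot.sound`)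

* §1 ★★ `exists_interp_of_towersDisjoint` — GENERIC: any `L ≥ 1`, any transporter family `T : ℕ → Site → Site → 𝔸ˣ`, any tower `Λ : ℕ → Set Site` whose blocks over the levels
  `≤ n` are pairwise disjoint in the block-label spelling ⊢ `∃ H' : XSpace d n 𝔸 →ₗ[ℂ] (Site d → 𝔸)` with (i) the interpolation clause for `QprimeIter (zdBlocking d L) T`, (ii) `H′Y(x) = 0`
  at every site under no tower, (iii) legs in `U1` ⇒ `‖H′Y(x)‖ ≤ ‖Y‖`, (iv) legs unitary ⇒ reality `(∀ p, Y p = −(X p)*) → H′Y = −(H′X)*` pointwise.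
* §2 ★★ `exists_interp_of_lamTop` — the `ZdIdx` edition AT THE BINDER SHAPE of the P₂D slot (located laws `IdxB8Laws`, `DomainSeq`, the (1.5) face): for every background `U₀` and every
  truncation `n ≤ k`, an `H′` with conjunct 11 of `SockLettersRD` VERBATIM at `(n, i.Λs n)`, conjunct 9, and — under the displayed hypothesis «`Ū₀ˡ` unitary-valued for `l < n`» —
  conjunct 6 with `B₀′_H := 1` and conjunct 10; ★ `exists_interp_at_binder` (the literal binder prefix `i.Ω 0 = univ → IdxB8LawsB L i → DomainSeq L i.Ω → (1.5) → …` of p619291).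
* §3 `exists_interp_idxB8SubD` — on the index of record `j : Node00.IdxB8SubD θ` (`θ : Node00.Stage3Params`; dag-n05-w2's `IdxB8SubD.towersDisjoint_blockMap`).
* §4 `exists_interp_of_lamTop_one` — at the trivial background `U₀ = 1` all four properties hold unconditionally.

## HONEST SCOPE

An INHABITATION certificate for four of the sixteen `SockLettersRD` clauses (11 and 9 outright; 6 and 10 under the displayed unitarity of the averaged backgrounds) by an explicit
blockwise witness, class-wide and background-wide; it shows the p613168 MECHANISM is absent on the repaired class.  It does NOT touch (1.92)'s weighted-derivative clause 7 or the
`Bd2(Δ H′X)` clause 8 (the blockwise-constant witness jumps at block faces — the smooth `H′` of [4] Thm 3.1 is N06 content), nor `G′ ∕ C ∕ R`, nor any estimate of [B8] ∕ [4]; the five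
(1.5)-keyed families of the N05 road remain HYPOTHESES.  Count-neutral; N05 NOT discharged; `T_η ↦ ℤᵈ`; one finite `𝕋⁴` programme at fixed `ε`, Bałaban as printed — the Yang–Mills
mass gap (Clay) is NOT proved by any of this; R4 closes the conditional finite-`𝕋⁴` rung `BalabanLadder.UV` only; nothing continuum ∕ ℝ⁴ ∕ OS.  No `sorry`, no `def`, no `instance`,
no `notation`.  Unit `pub-ymgap-dag-n05-w1` (g3), 2026-08-28.

RELATED IN THE TREE, NOT DUPLICATED (all USED BY NAME): `B8SockLettersRDIdxB8LawsBVacuity` (this seat g2: the negative twin), `B8IdxB8LamTopTowerDisjoint` (dag-n05-c: towers disjoint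
from (1.5)), `B8TowerBondsLayerLawSubD` (dag-n05-w2: the `IdxB8SubD` faces), `Node00/CarriersB8SubD` (this seat g2: the index), `B9B8AveragingKernelZd` (lit-balaban-p33: the kernel form
of `Q′_j`, `blockIter`, `compT`), `B9Eq325QprimeSingleSiteZd` (dag-n06-w4: single-site formula and `LevelDisjoint` for FINITE carriers — a different carrier; its member-class geometry
«NOT done here» is, for the `Ω₀ = ℤᵈ` law members, exactly dag-n05-c's disjointness used below), dag-n05-w2 g4's `B8SockLettersRDEmptyTowerInhabited` (ALL sixteen clauses at ONE
member — complementary).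

[cite: Balaban1985RegularSpaces, (1.3)–(1.6) p.77, (1.91)–(1.92) p.91, (1.107) p.94; Balaban1985BackgroundPropagators, (3.16)–(3.19) p.393, Thm 3.1 p.397; Balaban1985Averaging, (52)–(53) p.27, (56) p.27, Prop. 2 p.26]
-/

noncomputable section

open NormedSpace

namespace Literature.MathematicalPhysics.QuantumFieldTheory.Balaban1983to89.B8SockLettersRDInterpOfLamTop

open Literature.MathematicalPhysics.QuantumLattice (blockMap blockSites blockBase)
open B7Prop1Explicit B7Prop1Local
open B7Prop2Explicit (unitaryUnits unitaryUnits_le_U1 hol_mem_of avgIter)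
open B7Eq78Linearization (conjR conjR_apply conjR_add conjR_smul zdBlocking QprimeIter)
open B8Ineq130 (tlo thi)
open B8Ineq132 (Under conjR_conjR norm_conjR_le)
open B8Eq119TwistedAxial (bgT)
open B8Eq1117Concrete (XSpace)
open B8LeafModelZd (ZdIdx)
open B8ConstraintBonds (DomainSeq Lam)
open B8IdxB8LawsB (IdxB8LawsB)
open B8CubeMemberZd (inBox_tower_iff_under)
open B8Eq191FlatLettersCubeMember (under_iff_blockMap_eq)
open B8Eq191FlatStencils (conjR_unitOne)
open B9B8AveragingKernelZd (blockIter compT compT_zero compT_succ mem_blockIter_iff card_blockIter QprimeIter_zd_eq_sum_blockIter)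
open B8IdxB8LamTopTowerDisjoint (towers_disjoint_of_lamTop_blockMap)
open B8TowerBondsLayerLawSubD (IdxB8SubD.towersDisjoint_blockMap)
open Node00 (Stage3Params IdxB8Laws IdxB8SubD)

-- `Site` alone could resolve to the torus sites of `Setup.lean`; re-export the `ℤ^d` sites of `B7Prop1Explicit`.
export B7Prop1Explicit (Site)

variable {d : ℕ}

/-! ## §0 Plumbing: iterated block maps, composite transporters in a subgroup, `R(u)` and the adjoint -/

/-- `j` block maps of side `L` compose to the block map of side `Lʲ` (the `ℤᵈ` reading of «Bʲ(y)»; private plumbing). [cite: Balaban1985Averaging, (2) p.17, (43) p.24] -/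
private theorem iterate_blockMap_eq (L j : ℕ) (x : Site d) : (blockMap L)^[j] x = blockMap (L ^ j) x := by
  induction j generalizing x with
  | zero => funext i; simp [blockMap]
  | succ j ih => rw [Function.iterate_succ, Function.comp_apply, ih, B7BlockGeometry.blockMap_blockMap, pow_succ']

/-- **The composite transporter over a site reads only the legs along that site's ancestor chain**: if the legs `T_m(x_{m+1}, x_m)`, `m < j`, between the
consecutive block ancestors `x_m = blockMap^[m] x` of a fine site `x` lie in a subgroup `S`, so does `T^{(j)}(x_j, x)` (private plumbing; the induction of
`B9B8KnitLegsStraight.compT_mem_of`, localised to one chain). [cite: Balaban1985BackgroundPropagators, (3.19) p.393; Balaban1985Averaging, (52)–(53) p.27 (bookkeeping)] -/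
private theorem compT_mem_chain {𝔸 : Type*} [NormedRing 𝔸] [NormedAlgebra ℂ 𝔸] {S : Subgroup 𝔸ˣ} (L : ℕ) {T : ℕ → Site d → Site d → 𝔸ˣ} (x : Site d) :
    ∀ (j : ℕ), (∀ m, m < j → T m ((blockMap L)^[m + 1] x) ((blockMap L)^[m] x) ∈ S) → compT L T j ((blockMap L)^[j] x) x ∈ S
  | 0, _ => by rw [compT_zero]; exact S.one_mem
  | j + 1, hT => by
      rw [compT_succ]
      exact S.mul_mem (hT j (Nat.lt_succ_self j)) (compT_mem_chain L x j fun m hm => hT m (Nat.lt_succ_of_lt hm))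

/-- `(R(u)a)* = R(u)(a*)` for a unitary `u` (private plumbing; `B9Eq321LandauProjectionZd.star_conjR_of_mem_unitaryUnits`). [cite: Balaban1985Averaging, (56) p.27] -/
private theorem star_conjR_unitary {𝔸 : Type*} [NormedRing 𝔸] [StarRing 𝔸] [NormedAlgebra ℂ 𝔸] {u : 𝔸ˣ} (hu : u ∈ unitaryUnits 𝔸) (a : 𝔸) :
    star (conjR u a) = conjR u (star a) := by
  have hu' : (u : 𝔸) ∈ unitary 𝔸 := hu
  have hinv : ((u⁻¹ : 𝔸ˣ) : 𝔸) = star (u : 𝔸) :=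
    Units.inv_eq_of_mul_eq_one_right (Unitary.mul_star_self_of_mem hu')
  rw [conjR_apply, conjR_apply, hinv, star_mul, star_mul, star_star, mul_assoc]

/-- `R(c)(R(c⁻¹)v) = v` (private plumbing). [cite: Balaban1985Averaging, (56) p.27] -/
private theorem conjR_conjR_inv' {𝔸 : Type*} [NormedRing 𝔸] [NormedAlgebra ℂ 𝔸] (c : 𝔸ˣ) (v : 𝔸) : conjR c (conjR c⁻¹ v) = v := by
  rw [conjR_conjR, mul_inv_cancel, conjR_unitOne]

/-! ## §1 The generic construction: pairwise-disjoint towers ⇒ an interpolation letter -/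

section Generic

variable {𝔸 : Type*} [CStarAlgebra 𝔸] [Nontrivial 𝔸]

/-- ★★ **PAIRWISE-DISJOINT CONSTRAINT TOWERS CARRY AN INTERPOLATION LETTER**: for `L ≥ 1`, any family of level transporters `T` (in print `T_l(y, x) = R(Ū₀ˡ(Γ_{y,x}))`), any
truncation depth `n` and any tower `Λ` of constraint points whose blocks `Bʲ(y)` (`j ≤ n`, `y ∈ Λ_j`) are pairwise disjoint — a fine site whose level-`j` and level-`j′` block labels are
constraint points of those levels sees ONE constraint point — there is a `ℂ`-linear `H′ : XSpace d n 𝔸 → (ℤᵈ → 𝔸)` with (i) `Q′_j(H′Y)(y) = Y(j, y)` at every constraint point ([4] Thm 3.1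
«Q′H′ = I», print (1.107)); (ii) `H′Y(x) = 0` at every site under no constraint tower; (iii) if the legs `T_m(x_{m+1}, x_m)`, `m < j`, ALONG THE ANCESTOR CHAIN of every site `x` under a constraint point `(j, x_j)` (`x_m = blockMap (Lᵐ) x`) lie in
`{|u| ≤ 1, |u⁻¹| ≤ 1}` then `‖H′Y(x)‖ ≤ ‖Y‖` ((1.92)₀ with constant `1`); (iv) if those legs are unitary then `H′` is real: `Y = −X*` pointwise ⇒ `H′Y = −(H′X)*`
pointwise (the hypotheses of (iii)–(iv) are CHAIN-LOCAL, so a regional [3] Prop. 2 under the constraint towers suffices — the sequel file).  Witness: the blockwise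
transported constant `R(T^{(j)}(y, x))⁻¹ Y(j, y)` on `Bʲ(y)`, via the kernel form (3.19) of `Q′_j`.
[cite: Balaban1985BackgroundPropagators, (3.16)–(3.19) p.393, Thm 3.1 p.397; Balaban1985RegularSpaces, (1.91)–(1.92) p.91, (1.107) p.94; Balaban1985Averaging, (52)–(53) p.27] -/
theorem exists_interp_of_towersDisjoint {L : ℕ} (hL : 1 ≤ L) (T : ℕ → Site d → Site d → 𝔸ˣ) (n : ℕ) (Λ : ℕ → Set (Site d))
    (hdisj : ∀ j, j ≤ n → ∀ j', j' ≤ n → ∀ z ∈ Λ j, ∀ z' ∈ Λ j', ∀ x : Site d,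
      blockMap (L ^ j) x = z → blockMap (L ^ j') x = z' → j = j' ∧ z = z') :
    ∃ H' : XSpace d n 𝔸 →ₗ[ℂ] (Site d → 𝔸),
      (∀ (Y : XSpace d n 𝔸) (j : ℕ) (hj : j ≤ n) (y : Site d), y ∈ Λ j →
          QprimeIter (zdBlocking d L) T j (H' Y) y = Y (⟨j, Nat.lt_succ_of_le hj⟩, y)) ∧
      (∀ (Y : XSpace d n 𝔸) (x : Site d), (∀ j, j ≤ n → blockMap (L ^ j) x ∉ Λ j) → H' Y x = 0) ∧
      ((∀ j, j ≤ n → ∀ x : Site d, blockMap (L ^ j) x ∈ Λ j → ∀ m, m < j →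
          T m (blockMap (L ^ (m + 1)) x) (blockMap (L ^ m) x) ∈ U1 𝔸) → ∀ (Y : XSpace d n 𝔸) (x : Site d), ‖H' Y x‖ ≤ ‖Y‖) ∧
      ((∀ j, j ≤ n → ∀ x : Site d, blockMap (L ^ j) x ∈ Λ j → ∀ m, m < j →
          T m (blockMap (L ^ (m + 1)) x) (blockMap (L ^ m) x) ∈ unitaryUnits 𝔸) →
        ∀ X Y : XSpace d n 𝔸, (∀ p, Y p = -star (X p)) → ∀ x, H' Y x = -star (H' X x)) := by
  classical
  haveI : NeZero L := ⟨by omega⟩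
  -- the fine sites under SOME constraint tower of a level `≤ n`
  let P : Site d → Prop := fun x => ∃ j, j ≤ n ∧ blockMap (L ^ j) x ∈ Λ j
  -- the witness, pointwise
  let F : XSpace d n 𝔸 → Site d → 𝔸 := fun Y x =>
    if h : P x then conjR (compT L T h.choose (blockMap (L ^ h.choose) x) x)⁻¹ (Y (⟨h.choose, Nat.lt_succ_of_le h.choose_spec.1⟩, blockMap (L ^ h.choose) x)) else 0
  -- evaluation under a constraint tower: the chosen level IS the given one (disjointness)
  have hF : ∀ (Y : XSpace d n 𝔸) (x : Site d) (j : ℕ) (hj : j ≤ n), blockMap (L ^ j) x ∈ Λ j →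
      F Y x = conjR (compT L T j (blockMap (L ^ j) x) x)⁻¹ (Y (⟨j, Nat.lt_succ_of_le hj⟩, blockMap (L ^ j) x)) := by
    intro Y x j hj hmem
    have h : P x := ⟨j, hj, hmem⟩
    have hc := h.choose_spec
    have e : h.choose = j := (hdisj _ hc.1 _ hj _ hc.2 _ hmem x rfl rfl).1
    have key : ∀ (c : ℕ) (hc' : c ≤ n), c = j →
        conjR (compT L T c (blockMap (L ^ c) x) x)⁻¹ (Y (⟨c, Nat.lt_succ_of_le hc'⟩, blockMap (L ^ c) x)) =
          conjR (compT L T j (blockMap (L ^ j) x) x)⁻¹ (Y (⟨j, Nat.lt_succ_of_le hj⟩, blockMap (L ^ j) x)) := by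
      rintro c hc' rfl; rfl
    show (if h : P x then _ else _) = _
    rw [dif_pos h]
    exact key h.choose hc.1 e
  have hF0 : ∀ (Y : XSpace d n 𝔸) (x : Site d), ¬ P x → F Y x = 0 := fun Y x h => by
    show (if h : P x then _ else _) = _
    rw [dif_neg h]
  -- additivity and homogeneity (pointwise, case by case)
  have hadd : ∀ Y Z : XSpace d n 𝔸, F (Y + Z) = F Y + F Z := by
    intro Y Z; funext x
    by_cases h : P x
    · obtain ⟨j, hj, hmem⟩ := h
      rw [Pi.add_apply, hF _ x j hj hmem, hF _ x j hj hmem, hF _ x j hj hmem, BoundedContinuousFunction.coe_add, Pi.add_apply, conjR_add]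
    · rw [Pi.add_apply, hF0 _ x h, hF0 _ x h, hF0 _ x h, add_zero]
  have hsmul : ∀ (c : ℂ) (Y : XSpace d n 𝔸), F (c • Y) = c • F Y := by
    intro c Y; funext x
    by_cases h : P x
    · obtain ⟨j, hj, hmem⟩ := h
      rw [Pi.smul_apply, hF _ x j hj hmem, hF _ x j hj hmem, BoundedContinuousFunction.smul_apply, conjR_smul]
    · rw [Pi.smul_apply, hF0 _ x h, hF0 _ x h, smul_zero]
  refine ⟨{ toFun := F, map_add' := hadd, map_smul' := hsmul }, ?_, ?_, ?_, ?_⟩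
  · -- (i) the interpolation clause, by the kernel form of `Q′_j`
    intro Y j hj y hy
    show QprimeIter (zdBlocking d L) T j (F Y) y = _
    rw [QprimeIter_zd_eq_sum_blockIter]
    have hterm : ∀ x ∈ blockIter L j y, ((((L : ℝ) ^ d)⁻¹) ^ j) • conjR (compT L T j y x) (F Y x) =
        ((((L : ℝ) ^ d)⁻¹) ^ j) • Y (⟨j, Nat.lt_succ_of_le hj⟩, y) := by
      intro x hx
      have hlab : blockMap (L ^ j) x = y := by rw [← iterate_blockMap_eq]; exact (mem_blockIter_iff L j y x).1 hx
      have hmem : blockMap (L ^ j) x ∈ Λ j := by rw [hlab]; exact hy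
      rw [hF Y x j hj hmem, hlab, conjR_conjR_inv']
    rw [Finset.sum_congr rfl hterm, Finset.sum_const, card_blockIter, ← Nat.cast_smul_eq_nsmul ℝ, smul_smul]
    have h1 : ((((L ^ d) ^ j : ℕ) : ℝ) * (((L : ℝ) ^ d)⁻¹) ^ j) = 1 := by
      have hLd : ((L : ℝ) ^ d) ≠ 0 := by positivity
      push_cast
      rw [← mul_pow, mul_inv_cancel₀ hLd, one_pow]
    rw [h1, one_smul]
  · -- (ii) support: off the towers the witness vanishes
    intro Y x hx
    exact hF0 Y x fun ⟨j, hj, hmem⟩ => hx j hj hmem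
  · -- (iii) the sup bound with constant `1`, chain legs in `U1`
    intro hT Y x
    show ‖F Y x‖ ≤ ‖Y‖
    by_cases h : P x
    · obtain ⟨j, hj, hmem⟩ := h
      rw [hF Y x j hj hmem]
      have hc : compT L T j (blockMap (L ^ j) x) x ∈ U1 𝔸 := by
        rw [← iterate_blockMap_eq]
        exact compT_mem_chain L x j fun m hm => by
          rw [iterate_blockMap_eq, iterate_blockMap_eq]; exact hT j hj x hmem m hm
      exact (norm_conjR_le ((U1 𝔸).inv_mem hc) _).trans (BoundedContinuousFunction.norm_coe_le_norm Y _)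
    · rw [hF0 Y x h, norm_zero]; exact norm_nonneg _
  · -- (iv) reality, chain legs unitary
    intro hT X Y hXY x
    show F Y x = -star (F X x)
    by_cases h : P x
    · obtain ⟨j, hj, hmem⟩ := h
      have hc : compT L T j (blockMap (L ^ j) x) x ∈ unitaryUnits 𝔸 := by
        rw [← iterate_blockMap_eq]
        exact compT_mem_chain L x j fun m hm => by
          rw [iterate_blockMap_eq, iterate_blockMap_eq]; exact hT j hj x hmem m hm
      rw [hF Y x j hj hmem, hF X x j hj hmem, hXY, star_conjR_unitary ((unitaryUnits 𝔸).inv_mem hc), conjR_apply, conjR_apply]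
      noncomm_ring
    · rw [hF0 Y x h, hF0 X x h, star_zero, neg_zero]

end Generic

/-! ## §2 At the binder shape of the N05 slot: lawful, (1.3)–(1.4)-admissible members with the (1.5) face; every truncation, every background -/

section LamTop

variable {𝔸 : Type*} [CStarAlgebra 𝔸] [Nontrivial 𝔸]

omit [Nontrivial 𝔸] in
/-- The background legs `Ū₀ˡ(Γ_{Ly,x})` lie in a subgroup `S` as soon as the averaged background `Ū₀ˡ` is `S`-valued (private plumbing: `bgT = axialFn ∘ avgIter`, `hol_mem_of`).
[cite: Balaban1985Averaging, (78)–(80) p.30] -/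
private theorem bgT_mem_of {S : Subgroup 𝔸ˣ} (L : ℕ) {U₀ : Site d → Fin d → 𝔸ˣ} {l : ℕ} (h : ∀ x κ, avgIter L U₀ l x κ ∈ S) (y x : Site d) :
    bgT L U₀ l y x ∈ S := by
  unfold bgT axialFn
  exact hol_mem_of h _ _

/-- ★★ **[4]'s INTERPOLATION LETTER EXISTS AT EVERY (1.3)–(1.5)-ADMISSIBLE LAW MEMBER, EVERY TRUNCATION, EVERY BACKGROUND.**  For `L ≥ 1`, `i : ZdIdx d L` with NODE 00's located
laws `IdxB8Laws L i` (№8 truncation + the tower law), print's (1.3)–(1.4) `DomainSeq L i.Ω`, and the (1.5) face of the top tower, every truncation `n ≤ k` and every background `U₀`: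
there is a `ℂ`-linear `H′ : XSpace d n 𝔸 → (ℤᵈ → 𝔸)` with — conjunct 11 of `SockLettersRD` VERBATIM — `Q′_j(U₀)(H′Y)(y) = Y(j, y)` for all `j ≤ n`, `y ∈ Λs n j`; conjunct 9 «`H′X(x) = 0`
for `x ∉ Ω₀`»; and, if the averaged backgrounds `Ū₀ˡ` (`l < n`) are unitary-valued ([3] Prop. 2 under (52); `B8Prop7AdmittedFamily.avgIter_mem_unitaryUnits`), conjunct 6 with
`B₀′_H := 1` and conjunct 10 (reality).  The constraint towers of the truncation are pairwise disjoint by dag-n05-c's `towers_disjoint_of_lamTop_blockMap`; §1 does the rest.  Positive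
twin of `B8SockLettersRDIdxB8LawsBVacuity.interp_clause_false` (there: WITHOUT (1.5), at `Λ₀ = Λ₁ = ℤᵈ`, no `H′` exists).
[cite: Balaban1985RegularSpaces, (1.3)–(1.6) p.77, (1.91)–(1.92) p.91, (1.107) p.94; Balaban1985BackgroundPropagators, (3.16)–(3.19) p.393, Thm 3.1 p.397; Balaban1985Averaging, Prop. 2 p.26, (78)–(80) p.30] -/
theorem exists_interp_of_lamTop {L : ℕ} (hL : 1 ≤ L) (i : ZdIdx d L) (hlaws : IdxB8Laws L i) (hΩ : DomainSeq L i.Ω)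
    (hΛ : ∀ j, j < i.k → ∀ z ∈ i.Λs i.k j, ((L : ℤ) ^ j) • z ∈ Lam L i.Ω j)
    (U₀ : Site d → Fin d → 𝔸ˣ) {n : ℕ} (hn : n ≤ i.k) :
    ∃ H' : XSpace d n 𝔸 →ₗ[ℂ] (Site d → 𝔸),
      (∀ (Y : XSpace d n 𝔸) (j : ℕ) (hj : j ≤ n) (y : Site d), y ∈ i.Λs n j →
          QprimeIter (zdBlocking d L) (bgT L U₀) j (H' Y) y = Y (⟨j, Nat.lt_succ_of_le hj⟩, y)) ∧
      (∀ (X : XSpace d n 𝔸) (x : Site d), x ∉ i.Ω 0 → H' X x = 0) ∧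
      ((∀ l, l < n → ∀ x κ, avgIter L U₀ l x κ ∈ unitaryUnits 𝔸) →
        (∀ (X : XSpace d n 𝔸) (x : Site d), ‖H' X x‖ ≤ 1 * ‖X‖) ∧
        (∀ X Y : XSpace d n 𝔸, (∀ p, Y p = -star (X p)) → ∀ x, H' Y x = -star (H' X x))) := by
  obtain ⟨H', hint, hsupp, hnorm, hreal⟩ := exists_interp_of_towersDisjoint (𝔸 := 𝔸) hL (bgT L U₀) n (i.Λs n)
    (towers_disjoint_of_lamTop_blockMap hL i hlaws hΩ hΛ n hn)
  refine ⟨H', hint, fun X x hx => hsupp X x fun j hj hmem => hx ?_, fun hU => ⟨fun X x => ?_, ?_⟩⟩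
  · -- a site under a constraint tower of level `j` lies in `Ω_j ⊆ Ω₀` (the tower law at the truncation `n`)
    have hux : Under L j (blockMap (L ^ j) x) x := (under_iff_blockMap_eq hL j _ x).2 rfl
    have hxj : x ∈ i.Ω j := hlaws.tower_all n hn j hj _ hmem x ((inBox_tower_iff_under L j _ x).2 hux)
    exact hΩ.anti_le (Nat.zero_le j) hxj
  · rw [one_mul]
    exact hnorm (fun j hj x' _ m hm => unitaryUnits_le_U1 (bgT_mem_of L (hU m (lt_of_lt_of_le hm hj)) _ _)) X x
  · exact hreal fun j hj x' _ m hm => bgT_mem_of L (hU m (lt_of_lt_of_le hm hj)) _ _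

/-- ★ **AT THE LITERAL BINDER PREFIX OF THE P₂D SLOT** (p619291's `SLet ∕ SLetUB ∕ SB9P ∕ SH59src ∕ SB9srcHP`: `i.Ω 0 = univ → IdxB8LawsB L i → DomainSeq L i.Ω → (∀ l < i.k, ∀ z ∈ i.Λs i.k l,
Lˡ•z ∈ Lam L i.Ω l) → …`), for every truncation `1 ≤ n ≤ k` the letters range over and every background: the interpolation letter of `exists_interp_of_lamTop` (the four located laws
`IdxB8LawsB` contain `IdxB8Laws`; `Ω₀ = ℤᵈ` makes conjunct 9 moot but it is kept). [cite: Balaban1985RegularSpaces, (1.3)–(1.6) p.77, (1.107) p.94; Balaban1985BackgroundPropagators, Thm 3.1 p.397] -/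
theorem exists_interp_at_binder {L : ℕ} (hL : 1 ≤ L) (i : ZdIdx d L) (_h0 : i.Ω 0 = Set.univ) (hlaws : IdxB8LawsB L i) (hΩ : DomainSeq L i.Ω)
    (hΛ : ∀ l, l < i.k → ∀ z ∈ i.Λs i.k l, ((L : ℤ) ^ l) • z ∈ Lam L i.Ω l)
    (U₀ : Site d → Fin d → 𝔸ˣ) (n : ℕ) (_h1 : 1 ≤ n) (hn : n ≤ i.k) :
    ∃ H' : XSpace d n 𝔸 →ₗ[ℂ] (Site d → 𝔸),
      (∀ (Y : XSpace d n 𝔸) (j : ℕ) (hj : j ≤ n) (y : Site d), y ∈ i.Λs n j →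
          QprimeIter (zdBlocking d L) (bgT L U₀) j (H' Y) y = Y (⟨j, Nat.lt_succ_of_le hj⟩, y)) ∧
      (∀ (X : XSpace d n 𝔸) (x : Site d), x ∉ i.Ω 0 → H' X x = 0) ∧
      ((∀ l, l < n → ∀ x κ, avgIter L U₀ l x κ ∈ unitaryUnits 𝔸) →
        (∀ (X : XSpace d n 𝔸) (x : Site d), ‖H' X x‖ ≤ 1 * ‖X‖) ∧
        (∀ X Y : XSpace d n 𝔸, (∀ p, Y p = -star (X p)) → ∀ x, H' Y x = -star (H' X x))) :=
  exists_interp_of_lamTop hL i hlaws.toIdxB8Laws hΩ hΛ U₀ hn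

/-- **AT THE TRIVIAL BACKGROUND `U₀ = 1` ALL FOUR PROPERTIES HOLD OUTRIGHT** (`Ū₀ˡ = 1` is unitary): interpolation, support off `Ω₀`, `‖H′X(x)‖ ≤ ‖X‖`, reality — at every lawful
(1.3)–(1.5)-admissible member and every truncation `n ≤ k`.  (Contrast: at the all-`univ` datum of p613168, `U₀ = 1` is exactly where `interp_clause_false` was instantiated.)
[cite: Balaban1985RegularSpaces, (1.3)–(1.6) p.77, (1.107) p.94; Balaban1985BackgroundPropagators, Thm 3.1 p.397, Cor. 3.5 p.407 (U = 1)] -/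
theorem exists_interp_of_lamTop_one {L : ℕ} (hL : 1 ≤ L) (i : ZdIdx d L) (hlaws : IdxB8Laws L i) (hΩ : DomainSeq L i.Ω)
    (hΛ : ∀ j, j < i.k → ∀ z ∈ i.Λs i.k j, ((L : ℤ) ^ j) • z ∈ Lam L i.Ω j) {n : ℕ} (hn : n ≤ i.k) :
    ∃ H' : XSpace d n 𝔸 →ₗ[ℂ] (Site d → 𝔸),
      (∀ (Y : XSpace d n 𝔸) (j : ℕ) (hj : j ≤ n) (y : Site d), y ∈ i.Λs n j →
          QprimeIter (zdBlocking d L) (bgT L (1 : Site d → Fin d → 𝔸ˣ)) j (H' Y) y = Y (⟨j, Nat.lt_succ_of_le hj⟩, y)) ∧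
      (∀ (X : XSpace d n 𝔸) (x : Site d), x ∉ i.Ω 0 → H' X x = 0) ∧
      (∀ (X : XSpace d n 𝔸) (x : Site d), ‖H' X x‖ ≤ ‖X‖) ∧
      (∀ X Y : XSpace d n 𝔸, (∀ p, Y p = -star (X p)) → ∀ x, H' Y x = -star (H' X x)) := by
  obtain ⟨H', hint, hsupp, hU⟩ := exists_interp_of_lamTop (𝔸 := 𝔸) hL i hlaws hΩ hΛ 1 hn
  have h1 : ∀ l, l < n → ∀ (x : Site d) (κ : Fin d), avgIter L (1 : Site d → Fin d → 𝔸ˣ) l x κ ∈ unitaryUnits 𝔸 := fun l _ x κ => by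
    rw [B8Ineq132.avgIter_one]
    exact (unitaryUnits 𝔸).one_mem
  obtain ⟨hnorm, hreal⟩ := hU h1
  exact ⟨H', hint, hsupp, fun X x => (hnorm X x).trans_eq (one_mul _), hreal⟩

end LamTop

/-! ## §3 On the index of record `Node00.IdxB8SubD θ` -/

section Record

/-- `1 ≤ θ.L` (Bałaban's block size is odd `> 1`; private plumbing). [folklore] -/
private theorem one_le_L (θ : Stage3Params) : 1 ≤ θ.L := le_trans (by norm_num) θ.two_le_L

/-- **ON THE (1.5)-OBEYING SUB-INDEX OF RECORD** `IdxB8SubD θ` (the P₂D slot's Proposition-5 carriers, this seat's `Node00/CarriersB8SubD`): at every member `j`, every truncation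
`n ≤ k` and every background `U₀` over the record's coefficient algebra `θ.𝔸`, [4]'s interpolation letter with conjuncts 11 and 9 of `SockLettersRD`, and conjuncts 6 (`B₀′_H := 1`) ∕ 10
under unitary averaged backgrounds — dag-n05-w2's `IdxB8SubD.towersDisjoint_blockMap` at the truncation `n` and §1.
[cite: Balaban1985RegularSpaces, (1.3)–(1.6) p.77, (1.107) p.94; Balaban1985BackgroundPropagators, (3.16)–(3.19) p.393, Thm 3.1 p.397] -/
theorem exists_interp_idxB8SubD {θ : Stage3Params} (j : IdxB8SubD θ) (U₀ : Site θ.D → Fin θ.D → θ.𝔸ˣ) {n : ℕ} (hn : n ≤ j.1.1.1.1.k) :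
    ∃ H' : XSpace θ.D n θ.𝔸 →ₗ[ℂ] (Site θ.D → θ.𝔸),
      (∀ (Y : XSpace θ.D n θ.𝔸) (l : ℕ) (hl : l ≤ n) (y : Site θ.D), y ∈ j.1.1.1.1.Λs n l →
          QprimeIter (zdBlocking θ.D θ.L) (bgT θ.L U₀) l (H' Y) y = Y (⟨l, Nat.lt_succ_of_le hl⟩, y)) ∧
      (∀ (X : XSpace θ.D n θ.𝔸) (x : Site θ.D), x ∉ j.1.1.1.1.Ω 0 → H' X x = 0) ∧
      ((∀ l, l < n → ∀ x κ, avgIter θ.L U₀ l x κ ∈ unitaryUnits θ.𝔸) →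
        (∀ (X : XSpace θ.D n θ.𝔸) (x : Site θ.D), ‖H' X x‖ ≤ 1 * ‖X‖) ∧
        (∀ X Y : XSpace θ.D n θ.𝔸, (∀ p, Y p = -star (X p)) → ∀ x, H' Y x = -star (H' X x))) :=
  exists_interp_of_lamTop (one_le_L θ) j.1.1.1.1 j.laws j.domainSeq j.lamTop U₀ hn

end Record

end Literature.MathematicalPhysics.QuantumFieldTheory.Balaban1983to89.B8SockLettersRDInterpOfLamTop

end
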